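import Summits.HodgeConjecture.HodgeConjecture.Theorems.CyclicUnitaryPowersPLPackageOfMeridians
import Summits.HodgeConjecture.HodgeConjecture.Theorems.CyclicUnitaryPowersNodalMeridianExists
import Literature.AlgebraicGeometry.HodgeTheory.CyclicCoverNodalMeridianMonodromy
import Literature.AlgebraicGeometry.HodgeTheory.CyclicCoverDeckIsMonodromy
import HarnessLib

/-!
# Crux K1-A: the Picard–Lefschetz package, `VeryGeneralDeckCommutatorsInHg` and the rung leaf from the meridian fact
# RE-CUT TO ONE-NODAL CENTRES (route `CyclicUnitaryPowers`, item stmt-HodgeConjecture-19544)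

Prover seat `hodge-nonav-prover-Ax` (g8), cell `hodge-nonav`. Landed `--supports stmt-HodgeConjecture-19544`; sorry-free,
no definition, no new named fact here. CONDITIONAL results; nothing here says HC ∕ HC_AV is proved; rung F-H1 is not moved.

The registered binder `stub_ct99MeridianReflection` of crux K1 is `carlsonToledo1999_meridianMonodromy_isCyclicReflection`
(CT99 §6 Proposition for EVERY meridian of the discriminant, i.e. at every smooth centre — a statement containing the
folklore theorem "smooth point of the discriminant ⇒ one node"). This file derives the bundled Picard–Lefschetz package
`carlsonToledo1999_cyclicReflectionSystem` — hence K1 and the rung leaf — from the pointwise WEAKER fact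
`carlsonToledo1999_nodalMeridianMonodromy_isCyclicReflection` (file `Literature/…/CyclicCoverNodalMeridianMonodromy`:
§6 Proposition only for meridians whose CENTRE is a ONE-NODAL branch curve, the printed degeneration (kdoublept)):

* §1 `…_of_meridianMonodromy` — the every-meridian fact implies the nodal-centre fact (sanity: the re-cut is weaker);
  the convention-free consumer shape of the nodal fact.
* §2 `carlsonToledo1999_cyclicReflectionSystem_of_nodalMeridian_facts` — **nodal-centre fact → invariant-cycle fact →
  PL package**: as in `CyclicUnitaryPowersPLPackageOfMeridians` §4, but the set `𝓜` of generating reflections is indexed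
  by the meridians with ONE FIXED CENTRE, the coefficient vector of the explicit one-nodal ternary `p`-form
  `x₂^{p−2}x₀x₁ + x₀^p + x₁^p` (`CyclicUnitaryPowersNodalMeridianExists.exists_meridian_center_uninodal`: it is a smooth
  point of `V(D)` by the PROVED local structure of the discriminant at a nodal form, and carries a meridian at every base
  point); they generate `π₁` (`closure_meridian_loopClasses_center_eq_top`: Zariski–van Kampen and change of leash), are
  pairwise conjugate (`affineHypersurfaceComplement_meridian_isConj_holds`), and each is a cyclic reflection by the nodal
  fact; `nonempty_cyclicReflectionSystem_of_meridians'` assembles.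
* §3 with the invariant-cycle fact PROVED (`carlsonToledo1999_monodromyInvariants_eq_deckInvariants_holds`, Ax g7):
  **PL package ⟸ nodal-centre fact alone**, and **K1 `VeryGeneralDeckCommutatorsInHg` and the leaf
  `CyclicSurfacePowersHodge` ⟸ {nodal-centre fact, CT2 `carlsonToledo1999_finrank_eigenspace_inf_hodgePiece`, CDK
  `cmsp_nonHodgeGenericPoints_countable_algebraic_cover`}** — the K1-A floor with its Picard–Lefschetz input at the
  printed generality.

## References

* [CarlsonToledo1999] J. A. Carlson, D. Toledo, Duke Math. J. 97 (1999), §1, §2, §3, §6 (kdoublept) and Proposition, §7.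
* [Shimada2010ZvK] I. Shimada, arXiv:0906.1074, §3 Prop. 3.4.
* [VoisinHodgeII2003] C. Voisin, Hodge Theory and Complex Algebraic Geometry II, §2.1.1, §3.1.2, §6.2.1.
* [CattaniDeligneKaplan1995] E. Cattani, P. Deligne, A. Kaplan, J. Amer. Math. Soc. 8 (1995), Thm. 1.1, Cor. 1.2.
-/

noncomputable section

set_option linter.dupNamespace false

open CategoryTheory MvPolynomial _root_.Topology
open Literature.AlgebraicTopology.SingularHomology
open Literature.AlgebraicGeometry.Motives Literature.AlgebraicGeometry.Motives.UniversalHypersurface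
open Literature.AlgebraicGeometry.HodgeTheory Literature.AlgebraicGeometry.HodgeTheory.UniversalHypersurface
open Literature.AlgebraicGeometry.FundamentalGroup
open Summit.HodgeConjecture.HodgeConjecture.Theorems.SignSymmetricPowersMeridianMonodromy
open Summit.HodgeConjecture.HodgeConjecture.Theorems.CyclicUnitaryPowersPLPackageOfMeridians
open Summit.HodgeConjecture.HodgeConjecture.Theorems.CyclicUnitaryPowersNodalMeridianExists

namespace Summit.HodgeConjecture.HodgeConjecture.Theorems.CyclicUnitaryPowersPLPackageOfNodalMeridian

/-! ### §1 The re-cut is weaker; its consumer shape -/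

/-- **The every-meridian fact implies the nodal-centre fact** (the extra hypothesis is simply dropped): the re-cut
is pointwise weaker than the registered binder `carlsonToledo1999_meridianMonodromy_isCyclicReflection`.
[cite: CarlsonToledo1999, §6 Proposition (held text p0014)] -/
theorem carlsonToledo1999_nodalMeridianMonodromy_isCyclicReflection_of_meridianMonodromy
    (H : carlsonToledo1999_meridianMonodromy_isCyclicReflection) :
    carlsonToledo1999_nodalMeridianMonodromy_isCyclicReflection :=
  fun _ _ hodd h3 f hf hf0 hX e he τ hτ D hD hDeq χ hχ μ _ γ hγ =>
    H hodd h3 f hf hf0 hX e he τ hτ D hD hDeq χ hχ μ γ hγ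

section Consumer

variable {p : ℕ} [NeZero p]

/-- **The cyclic reflection of a meridian with one-nodal centre lies in the monodromy group** (convention-free
form): with the data of the nodal fact, some element of `ratMonodromyGroup u 2 _ [F]` — the meridian's transport or its
inverse — is the cyclic reflection along the vanishing space `ℚ[τ]δ`. [cite: CarlsonToledo1999, §6 Proposition (held text p0014)] -/
theorem exists_reflection_mem_ratMonodromyGroup_of_nodal
    (H : carlsonToledo1999_nodalMeridianMonodromy_isCyclicReflection) (hodd : Odd p) (h3 : 3 ≤ p)
    {f : MvPolynomial (Fin 3) ℂ} (hf : f.IsHomogeneous p) (hf0 : f ≠ 0)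
    (hX : IsSmoothProjective 2 (SmoothHypersurface.hypersurface (cyclicCoverForm p f)))
    {e : fiberOver (cyclicCoverFamily p) (cyclicCoverPoint p f) ≅
      SmoothHypersurface.hypersurface (cyclicCoverForm p f)} (he : IsCompatibleFibreIso p e)
    {τ : bettiCohomology (fiberOver (cyclicCoverFamily p) (cyclicCoverPoint p f)) 2 ≃ₗ[ℚ]
      bettiCohomology (fiberOver (cyclicCoverFamily p) (cyclicCoverPoint p f)) 2}
    (hτ : ∀ (ha : deckUnit p ∈ diagonalStabilizer (cyclicCoverForm p f))
      (x : bettiCohomology (fiberOver (cyclicCoverFamily p) (cyclicCoverPoint p f)) 2),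
      BettiUniverse.pullEquiv e 2 (τ x) =
        BettiUniverse.pull (diagonalAut (cyclicCoverForm p f) ha) 2 (BettiUniverse.pullEquiv e 2 x))
    {D : MvPolynomial (TernaryIndex p) ℂ} (hD : Irreducible D) (hDeq : IsDiscriminantEquation p D)
    {χ : ComplexPoints (cyclicCoverBase p) ≃ₜ affineHypersurfaceComplement ![D]} (hχ : IsCoefficientChart p D χ)
    (μ : Meridian ![D] (χ (cyclicCoverPoint p f)) 0)
    (hμ : ∃ x : Fin 3 → ℂ, IsNodalFormWithNodes (n := 1)
      (∑ e : TernaryIndex p, MvPolynomial.monomial e.1 (μ.y e)) ![x])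
    (γ : Path (cyclicCoverPoint p f) (cyclicCoverPoint p f)) (hγ : ∀ θ, χ (γ θ) = μ.loop θ) :
    ∃ (T r : bettiCohomology (fiberOver (cyclicCoverFamily p) (cyclicCoverPoint p f)) 2 ≃ₗ[ℚ]
        bettiCohomology (fiberOver (cyclicCoverFamily p) (cyclicCoverPoint p f)) 2)
      (δ : bettiCohomology (fiberOver (cyclicCoverFamily p) (cyclicCoverPoint p f)) 2),
      IsRatTransport (cyclicCoverFamily p) 2 (cyclicCoverFamily_locallyTrivial p) (cyclicCoverLoopClass p γ) T ∧
      (r = T ∨ r = T⁻¹) ∧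
      r ∈ ratMonodromyGroup (cyclicCoverFamily p) 2 (cyclicCoverFamily_locallyTrivial p)
        ⟨cyclicCoverPoint p f, Set.mem_univ _⟩ ∧
      δ ≠ 0 ∧ (∑ i ∈ Finset.range p, (τ ^ i) δ) = 0 ∧
      Module.finrank ℚ (cyclicSpan τ δ) = p - 1 ∧
      (∀ x ∈ cyclicSpan τ δ, (∀ y ∈ cyclicSpan τ δ, transportedTraceForm hX e 2 x y = 0) → x = 0) ∧
      IsCyclicReflection (transportedTraceForm hX e 2) τ δ r := by
  obtain ⟨T, δ, hT, h0, hΦ, hdim, hnd, hrefl⟩ := H hodd h3 f hf hf0 hX e he τ hτ D hD hDeq χ hχ μ hμ γ hγ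
  have hTΓ : T ∈ ratMonodromyGroup (cyclicCoverFamily p) 2 (cyclicCoverFamily_locallyTrivial p)
      ⟨cyclicCoverPoint p f, Set.mem_univ _⟩ := mem_ratMonodromyGroup_of_isRatTransport _ _ _ hT
  rcases hrefl with hrefl | hrefl
  · exact ⟨T, T, δ, hT, Or.inl rfl, hTΓ, h0, hΦ, hdim, hnd, hrefl⟩
  · exact ⟨T, T⁻¹, δ, hT, Or.inr rfl, Subgroup.inv_mem _ hTΓ, h0, hΦ, hdim, hnd, hrefl⟩

end Consumer

/-! ### §2 The package from the nodal-centre fact and the invariant-cycle fact -/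

section Assembly

variable {p : ℕ} [NeZero p]

/-- **PL_A from the nodal-centre meridian fact.** The bundled Picard–Lefschetz package of the universal family of
`p`-cyclic covers of the plane (`carlsonToledo1999_cyclicReflectionSystem`: CT99 §2 + §3 + §6 + §7) FOLLOWS from the
LOCAL fact at one-nodal centres (§6 Proposition at (kdoublept)) and the invariant-cycle fact (§3 ¶2): the generating
reflections are the transports of the meridians centred at ONE explicit one-nodal branch curve
(`exists_meridian_center_uninodal`), which generate the monodromy group (`closure_meridian_loopClasses_center_eq_top`,
through the monodromy representation on `π₁`), are pairwise conjugate up to inversion (meridian conjugacy) and are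
cyclic reflections (the nodal fact); `nonempty_cyclicReflectionSystem_of_meridians'` assembles. CONDITIONAL on the two
cited facts; nothing here says HC ∕ HC_AV is proved.
[cite: CarlsonToledo1999, §2, §3, §6 (kdoublept) and Proposition, §7 last paragraph] [cite: Shimada2010ZvK, §3 Prop. 3.4] -/
theorem carlsonToledo1999_cyclicReflectionSystem_of_nodalMeridian_facts
    (H1 : carlsonToledo1999_nodalMeridianMonodromy_isCyclicReflection)
    (H2 : carlsonToledo1999_monodromyInvariants_eq_deckInvariants) :
    carlsonToledo1999_cyclicReflectionSystem := by
  intro p _ hodd h3 f hf hf0 hX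
  have hp2 : 2 ≤ p := by omega
  have hp0 : p ≠ 0 := by omega
  have hJ := CyclicCoverFormNonsingular.isNonsingularForm_cyclicCoverForm_of_isSmoothProjective hp2 hf hf0 hX
  -- the identification and the covering automorphism
  obtain ⟨e, he⟩ := exists_isCompatibleFibreIso p hf hJ
  obtain ⟨τ, hτ⟩ := exists_deck_intertwining e
  refine ⟨e, τ, hτ, ?_⟩
  have hBs : (transportedTraceForm hX e 2).IsSymm := transportedTraceForm_isSymm hX e (by decide)
  have hBnd : (transportedTraceForm hX e 2).Nondegenerate := transportedTraceForm_nondegenerate hX e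
  have hBτ : ∀ x y, transportedTraceForm hX e 2 (τ x) (τ y) = transportedTraceForm hX e 2 x y :=
    transportedTraceForm_deck hX e hτ
  -- the coefficient chart of the base and an irreducible equation of the discriminant
  obtain ⟨D, hDirr, hDeq⟩ := exists_irreducible_discriminantEquation p hp2
  obtain ⟨χ, hχ⟩ := exists_homeomorph_affineHypersurfaceComplement p hDeq
  have hDeq' : IsDiscriminantEquation p D := hDeq
  have hχ' : IsCoefficientChart p D χ := hχ
  have hirr : ∀ j : Fin 1, Irreducible ((![D] : Fin 1 → MvPolynomial (TernaryIndex p) ℂ) j) := fun j => by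
    fin_cases j; exact hDirr
  -- base points and the pointed homeomorphism `Set.univ ≃ₜ {D ≠ 0}`
  let s₀ : ComplexPoints (cyclicCoverBase p) := cyclicCoverPoint p f
  let u₀ : (Set.univ : Set (ComplexPoints (cyclicCoverBase p))) := ⟨s₀, Set.mem_univ _⟩
  let Ψ : (Set.univ : Set (ComplexPoints (cyclicCoverBase p))) ≃ₜ affineHypersurfaceComplement ![D] :=
    (Homeomorph.Set.univ _).trans χ
  have hΨ : Ψ.symm (χ s₀) = u₀ := by
    rw [Homeomorph.symm_apply_eq]
    rfl
  let φ := FundamentalGroup.mapOfEq (Ψ.symm : C(affineHypersurfaceComplement ![D],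
    (Set.univ : Set (ComplexPoints (cyclicCoverBase p))))) hΨ
  have hφsurj : Function.Surjective φ := mapOfEq_surjective_of_homeomorph Ψ.symm hΨ
  -- the monodromy representation on `π₁(Set.univ, u₀)`
  obtain ⟨ρ, hρ, hrange⟩ := exists_monodromyHom (cyclicCoverFamily p) 2 (cyclicCoverFamily_locallyTrivial p)
    (isRationalClass_transportFun_cyclicCoverFamily) u₀
  -- ONE meridian centred at a one-nodal branch curve (the degeneration (kdoublept), CHOSEN)
  obtain ⟨μ₀, x₀, hnod₀⟩ := exists_meridian_center_uninodal h3 hDirr hDeq' (χ s₀)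
  -- reading a meridian loop back in `S(ℂ)`
  have hread : ∀ μ : Meridian ![D] (χ s₀) 0, ∃ γ : Path s₀ s₀, (∀ θ, χ (γ θ) = μ.loop θ) ∧
      FundamentalGroup.toPath (φ μ.loopClass) = cyclicCoverLoopClass p γ := by
    intro μ
    have hx : s₀ = χ.symm (χ s₀) := (χ.symm_apply_apply s₀).symm
    refine ⟨(μ.loop.map χ.symm.continuous).cast hx hx, fun θ => ?_, ?_⟩
    · change χ (χ.symm (μ.loop θ)) = μ.loop θ
      exact χ.apply_symm_apply _
    · dsimp only [φ]
      erw [Meridian.loopClass_def, mapOfEq_fromPath_mk]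
      change Path.Homotopic.Quotient.mk _ = Path.Homotopic.Quotient.mk _
      congr 1
  -- the reflections of the meridians centred at `μ₀.y`: `r_μ ∈ {T_μ, T_μ⁻¹}` the cyclic reflection (H1)
  have hmer : ∀ μ : Meridian ![D] (χ s₀) 0, μ.y = μ₀.y →
      ∃ (r : bettiCohomology (fiberOver (cyclicCoverFamily p) (cyclicCoverPoint p f)) 2 ≃ₗ[ℚ]
          bettiCohomology (fiberOver (cyclicCoverFamily p) (cyclicCoverPoint p f)) 2)
        (δ : bettiCohomology (fiberOver (cyclicCoverFamily p) (cyclicCoverPoint p f)) 2),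
        (r = ρ (φ μ.loopClass) ∨ r = (ρ (φ μ.loopClass))⁻¹) ∧
        δ ≠ 0 ∧ (∑ i ∈ Finset.range p, (τ ^ i) δ) = 0 ∧ Module.finrank ℚ (cyclicSpan τ δ) = p - 1 ∧
        (∀ x ∈ cyclicSpan τ δ, (∀ y ∈ cyclicSpan τ δ, transportedTraceForm hX e 2 x y = 0) → x = 0) ∧
        IsCyclicReflection (transportedTraceForm hX e 2) τ δ r := by
    intro μ hμy
    obtain ⟨γ, hγ, hcls⟩ := hread μ
    have hμ : ∃ x : Fin 3 → ℂ, IsNodalFormWithNodes (n := 1)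
        (∑ e : TernaryIndex p, MvPolynomial.monomial e.1 (μ.y e)) ![x] := ⟨x₀, by rw [hμy]; exact hnod₀⟩
    obtain ⟨T, r, δ, hT, hrT, -, h0, hΦ, hdim, hnd, hrefl⟩ :=
      exists_reflection_mem_ratMonodromyGroup_of_nodal H1 hodd h3 hf hf0 hX he hτ hDirr hDeq' hχ' μ hμ γ hγ
    have hTρ : ρ (φ μ.loopClass) = T := by
      refine isRatTransport_unique (cyclicCoverFamily p) 2 (cyclicCoverFamily_locallyTrivial p) (hρ _) ?_
      rw [hcls]
      exact hT
    rw [hTρ]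
    exact ⟨r, δ, hrT, h0, hΦ, hdim, hnd, hrefl⟩
  -- the set of reflections of the meridians centred at `μ₀.y`
  let 𝓜 : Set (bettiCohomology (fiberOver (cyclicCoverFamily p) (cyclicCoverPoint p f)) 2 ≃ₗ[ℚ]
      bettiCohomology (fiberOver (cyclicCoverFamily p) (cyclicCoverPoint p f)) 2) :=
    {r | ∃ μ : Meridian ![D] (χ s₀) 0, μ.y = μ₀.y ∧ (r = ρ (φ μ.loopClass) ∨ r = (ρ (φ μ.loopClass))⁻¹) ∧
      ∃ δ : bettiCohomology (fiberOver (cyclicCoverFamily p) (cyclicCoverPoint p f)) 2,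
        δ ≠ 0 ∧ (∑ i ∈ Finset.range p, (τ ^ i) δ) = 0 ∧ Module.finrank ℚ (cyclicSpan τ δ) = p - 1 ∧
        (∀ x ∈ cyclicSpan τ δ, (∀ y ∈ cyclicSpan τ δ, transportedTraceForm hX e 2 x y = 0) → x = 0) ∧
        IsCyclicReflection (transportedTraceForm hX e 2) τ δ r}
  have hρmem : ∀ c, ρ c ∈ ratMonodromyGroup (cyclicCoverFamily p) 2 (cyclicCoverFamily_locallyTrivial p) u₀ :=
    fun c => hrange ▸ ⟨c, rfl⟩
  haveI : Module.Finite ℚ (bettiCohomology (fiberOver (cyclicCoverFamily p) (cyclicCoverPoint p f)) 2) :=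
    BettiUniverse.finite ((isSmoothProjectiveFamily_cyclicCoverFamily p).isSmoothProjective (cyclicCoverPoint p f)) 2
  refine nonempty_cyclicReflectionSystem_of_meridians' hBs hBnd hBτ hp0 (𝓜 := 𝓜) ?_ ?_ ?_ ?_ ?_
  · -- `𝓜 ⊆ Γ`
    rintro r ⟨μ, -, hr, -⟩
    rcases hr with rfl | rfl
    · exact hρmem _
    · exact Subgroup.inv_mem _ (hρmem _)
  · -- `Γ ≤ closure 𝓜`: Zariski–van Kampen from `μ₀` through `φ` and `ρ` (conjugates keep the centre)
    have hclos := closure_meridian_loopClasses_center_eq_top hDirr μ₀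
    have hclos' : Subgroup.closure (φ '' {c | ∃ μ : Meridian ![D] (χ s₀) 0, μ.y = μ₀.y ∧ c = μ.loopClass}) = ⊤ := by
      rw [← MonoidHom.map_closure, hclos, ← MonoidHom.range_eq_map, MonoidHom.range_eq_top.mpr hφsurj]
    intro g hg
    rw [← hrange] at hg
    obtain ⟨c, rfl⟩ := hg
    have hc : c ∈ Subgroup.closure (φ '' {c | ∃ μ : Meridian ![D] (χ s₀) 0, μ.y = μ₀.y ∧ c = μ.loopClass}) := by
      rw [hclos']; exact Subgroup.mem_top c
    have hmap : ρ c ∈ (Subgroup.closure (φ '' {c | ∃ μ : Meridian ![D] (χ s₀) 0,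
        μ.y = μ₀.y ∧ c = μ.loopClass})).map ρ :=
      Subgroup.mem_map_of_mem ρ hc
    rw [MonoidHom.map_closure] at hmap
    refine (Subgroup.closure_le _).mpr ?_ hmap
    rintro _ ⟨_, ⟨_, ⟨μ, hμy, rfl⟩, rfl⟩, rfl⟩
    obtain ⟨r, δ, hr, hrest⟩ := hmer μ hμy
    have hr𝓜 : r ∈ 𝓜 := ⟨μ, hμy, hr, δ, hrest⟩
    rcases hr with hr | hr
    · rw [← hr]; exact Subgroup.subset_closure hr𝓜
    · have : ρ (φ μ.loopClass) = r⁻¹ := by rw [hr, inv_inv]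
      rw [this]; exact Subgroup.inv_mem _ (Subgroup.subset_closure hr𝓜)
  · -- any two meridian reflections are conjugate up to inversion (meridian conjugacy)
    rintro r₁ ⟨μ₁, -, hr₁, -⟩ r₂ ⟨μ₂, -, hr₂, -⟩
    have hconj := affineHypersurfaceComplement_meridian_isConj_holds (TernaryIndex p) 1 ![D] hirr (χ s₀) 0 μ₁ μ₂
    obtain ⟨c, hc⟩ := isConj_iff.mp hconj
    have hT : ρ (φ μ₂.loopClass) = ρ (φ c) * ρ (φ μ₁.loopClass) * (ρ (φ c))⁻¹ := by
      rw [← hc, map_mul, map_mul, map_inv, map_mul, map_mul, map_inv]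
    refine ⟨ρ (φ c), hρmem _, ?_⟩
    rcases hr₁ with rfl | rfl <;> rcases hr₂ with rfl | rfl
    · exact Or.inl hT
    · right; rw [hT]; simp only [mul_inv_rev, inv_inv, mul_assoc]
    · right; rw [hT, inv_inv]
    · left; rw [hT]; simp only [mul_inv_rev, inv_inv, mul_assoc]
  · -- the local Picard–Lefschetz content (H1 at the one-nodal centre)
    rintro r ⟨μ, -, -, δ, hrest⟩
    exact ⟨δ, hrest⟩
  · -- monodromy invariants are `τ`-invariant (H2)
    exact fun x hx => H2 hodd h3 f hf hf0 hX e he τ hτ x hx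

/-- **The bundled cited fact `nonempty_carlsonToledoFamily` from the nodal-centre fact and the invariant-cycle fact.**
CONDITIONAL. [cite: CarlsonToledo1999, §2, §3, §6 Proposition, §7 last paragraph] -/
theorem nonempty_carlsonToledoFamily_of_nodalMeridian_facts
    (H1 : carlsonToledo1999_nodalMeridianMonodromy_isCyclicReflection)
    (H2 : carlsonToledo1999_monodromyInvariants_eq_deckInvariants) : nonempty_carlsonToledoFamily :=
  nonempty_carlsonToledoFamily_of_cyclicReflectionSystem
    (carlsonToledo1999_cyclicReflectionSystem_of_nodalMeridian_facts H1 H2)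

end Assembly

/-! ### §3 The package, crux K1 and the rung leaf from the nodal-centre fact (the invariant-cycle fact is proved) -/

section Crux

/-- **PL_A ⟸ the nodal-centre meridian fact ALONE**: the invariant-cycle half is the tree theorem
`carlsonToledo1999_monodromyInvariants_eq_deckInvariants_holds` (the covering transformation is the monodromy of the
scaling loop). CONDITIONAL on the one cited fact. [cite: CarlsonToledo1999, §2, §3, §6 (kdoublept) and Proposition, §7] -/
theorem carlsonToledo1999_cyclicReflectionSystem_of_nodalMeridian
    (H1 : carlsonToledo1999_nodalMeridianMonodromy_isCyclicReflection) :
    carlsonToledo1999_cyclicReflectionSystem :=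
  carlsonToledo1999_cyclicReflectionSystem_of_nodalMeridian_facts H1
    carlsonToledo1999_monodromyInvariants_eq_deckInvariants_holds

/-- **Crux K1 `VeryGeneralDeckCommutatorsInHg` modulo THREE cited facts with the Picard–Lefschetz input at printed
generality**: the nodal-centre meridian fact (CT99 §6 Proposition at (kdoublept)), the eigen-Hodge numbers CT2 (CT99 §5;
a theorem modulo Griffiths' residue kernel) and the CDK cover. CONDITIONAL; nothing here says HC ∕ HC_AV is proved.
[cite: CarlsonToledo1999, §5, §6 (kdoublept) and Proposition] [cite: CattaniDeligneKaplan1995, Thm. 1.1 and Cor. 1.2] -/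
theorem veryGeneralDeckCommutatorsInHg_of_nodalMeridian_facts
    (H1 : carlsonToledo1999_nodalMeridianMonodromy_isCyclicReflection)
    (hCT2 : carlsonToledo1999_finrank_eigenspace_inf_hodgePiece)
    (hCDK : cmsp_nonHodgeGenericPoints_countable_algebraic_cover) :
    Summit.HodgeConjecture.HodgeConjecture.Theses.CyclicUnitaryPowers.VeryGeneralDeckCommutatorsInHg :=
  CyclicUnitaryPowersThreePrintFacts.veryGeneralDeckCommutatorsInHg_of_three_print_facts
    (carlsonToledo1999_cyclicReflectionSystem_of_nodalMeridian H1) @hCT2 @hCDK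

/-- **The rung-F-H1 leaf `CyclicSurfacePowersHodge` modulo the same three facts.** CONDITIONAL; rung F-H1 not moved.
[cite: CarlsonToledo1999, §5, §6 (kdoublept) and Proposition] [cite: CattaniDeligneKaplan1995, Thm. 1.1 and Cor. 1.2] -/
theorem cyclicSurfacePowersHodge_of_nodalMeridian_facts
    (H1 : carlsonToledo1999_nodalMeridianMonodromy_isCyclicReflection)
    (hCT2 : carlsonToledo1999_finrank_eigenspace_inf_hodgePiece)
    (hCDK : cmsp_nonHodgeGenericPoints_countable_algebraic_cover) :
    Summit.HodgeConjecture.HodgeConjecture.Theses.CyclicUnitaryPowers.CyclicSurfacePowersHodge :=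
  CyclicUnitaryPowersThreePrintFacts.cyclicSurfacePowersHodge_of_three_print_facts
    (carlsonToledo1999_cyclicReflectionSystem_of_nodalMeridian H1) @hCT2 @hCDK

end Crux

end Summit.HodgeConjecture.HodgeConjecture.Theorems.CyclicUnitaryPowersPLPackageOfNodalMeridian

end
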